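import Literature.AlgebraicGeometry.Frobenioids.SubAmpleTestBase
import Literature.AlgebraicGeometry.Frobenioids.ModelFrobenioidIsFrobenioid
import Literature.AlgebraicGeometry.Frobenioids.ArchimedeanDivisors
import Literature.AlgebraicGeometry.Frobenioids.ArithmeticFrobenioidHypotheses
import Literature.AlgebraicGeometry.Frobenioids.FrTrFrobenioid
import Literature.AlgebraicGeometry.Frobenioids.BiratGerms
import Literature.AlgebraicGeometry.Frobenioids.FiberProducts
import HarnessLib

/-!
# The divisor monoid and the model Frobenioid over the three-object test base (test object for
# [FrdI] Prop. 1.6 (vi), clause «Aut^sub-ample»)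

Mochizuki, *The geometry of Frobenioids I: the general theory*, Kyushu J. Math. **62** (2008)
293–400, §1, Definition 1.1 (i)(ii) p. 19 (divisorial monoids; monoids on a category),
Proposition 1.6 (vi) p. 28, and §5, Theorem 5.2 (i)(ii) pp. 100–101 (model Frobenioids)
[cite: MochizukiFrdI2008, Prop. 1.6(vi) p.28].

OURS (abc-iut cell, seat abc-iut-found gen 2; not a construction of the paper) — the second file of
the kernel witness against the clause «Aut^sub-ample» of Prop. 1.6 (vi) (first file:
`SubAmpleTestBase.lean`, the base category `D` with objects `P`, `Q`, `E`).  Here: the divisor monoid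
`Φt` on `D` with `Φt(P) = Φt(Q) = ℝ_{≥0}` and `Φt(E) = L`, the LEXICOGRAPHIC CONE
`L = {(x, n) ∈ ℝ × ℕ : n = 0 ⇒ x ≥ 0}` (a divisorial monoid which is not finitely generated: the
direction `(0, 1)` absorbs every real), with pull-backs `(b k)^* = ×4^k`, `(f j)^* = ×4^{-j}`,
`(φ i)^* = ×2^i` on `ℝ_{≥0}`, `(c k)^* (x, n) = (4^k x, n)`, `(h i)^* (x) = (2^i x, 0)`; `Φt` is a
divisorial monoid on `D` in the sense of Def. 1.1 (ii) (all pull-backs injective into sharp monoids;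
the FSM-morphisms of `D` — isomorphisms and the `f j` — pull back bijectively).  The Frobenioid of the
witness is THE MODEL FROBENIOID ([FrdI] Thm. 5.2 (i), `ModelFrobenioid`) of the data
`(Φt, B = 0_D, Div_B = 0)`, a Frobenioid by the cell's kernel theorem `ModelFrobenioid.isFrobenioid`
(Thm. 5.2 (ii), abc-iut-found gen 0): objects `(A_D, α)` with `α ∈ Φt(A_D)^gp`, arrows
`(n, u, z) : (A_D, α) → (B_D, β)` with `n·α + z = u^*β`, `z ∈ Φt(A_D)`.  The distinguished objects:
`A = (Q, −1)` (NOT effective) and the witness objects `Y = (E, −(0,1))`; the third file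
`AutSubAmpleFiberProductCounterexample.lean` shows that `A` is `Aut^sub`-ample while `(A, Q, id)` is
not `Aut^sub`-ample in `C ×_D D` along the collapsing functor `κ`.
Nothing here bears on [IUTchIII] Cor. 3.12.
-/

noncomputable section

open scoped NNReal

namespace Literature.AlgebraicGeometry.Frobenioids

open CategoryTheory Opposite

namespace SubAmpleTest

/-! ### The lexicographic cone `L ⊆ ℝ × ℕ` -/

/-- The lexicographic cone `L = {(x, n) ∈ ℝ × ℕ : n = 0 ⇒ 0 ≤ x}`: all of `ℝ × ℕ_{≥1}` together with
`ℝ_{≥0} × {0}` — an additive submonoid of `ℝ × ℕ` (OURS). [cite: MochizukiFrdI2008, Def. 1.1(i) p.19] -/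
def lexCone : AddSubmonoid (ℝ × ℕ) where
  carrier := {p | p.2 = 0 → 0 ≤ p.1}
  zero_mem' := fun _ => le_rfl
  add_mem' := by
    rintro ⟨x, m⟩ ⟨y, n⟩ hx hy hmn
    obtain ⟨hm, hn⟩ := Nat.add_eq_zero_iff.mp hmn
    exact add_nonneg (hx hm) (hy hn)

/-- `L` written multiplicatively (the convention of this directory). [cite: MochizukiFrdI2008, Def. 1.1(i) p.19] -/
abbrev L : Type := Multiplicative lexCone

/-- The underlying pair `(x, n) ∈ ℝ × ℕ` of an element of `L`. [cite: MochizukiFrdI2008, Def. 1.1(i) p.19] -/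
def pr (a : L) : ℝ × ℕ := (Multiplicative.toAdd a).1

/-- The defining property of `L`: `n = 0 ⇒ 0 ≤ x`. [cite: MochizukiFrdI2008, Def. 1.1(i) p.19] -/
theorem pr_nonneg (a : L) (h : (pr a).2 = 0) : 0 ≤ (pr a).1 := (Multiplicative.toAdd a).2 h

/-- `pr` is injective. [cite: MochizukiFrdI2008, Def. 1.1(i) p.19] -/
theorem pr_injective : Function.Injective pr := fun _ _ h =>
  Multiplicative.toAdd.injective (Subtype.ext h)

/-- Extensionality in `L`. [cite: MochizukiFrdI2008, Def. 1.1(i) p.19] -/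
theorem L_ext {a b : L} (h : pr a = pr b) : a = b := pr_injective h

/-- `pr (a · b) = pr a + pr b`. [cite: MochizukiFrdI2008, Def. 1.1(i) p.19] -/
@[simp] theorem pr_mul (a b : L) : pr (a * b) = pr a + pr b := rfl

/-- `pr 1 = 0`. [cite: MochizukiFrdI2008, Def. 1.1(i) p.19] -/
@[simp] theorem pr_one : pr 1 = 0 := rfl

/-- `pr (a ^ n) = n • pr a`. [cite: MochizukiFrdI2008, Def. 1.1(i) p.19] -/
@[simp] theorem pr_pow (a : L) (n : ℕ) : pr (a ^ n) = n • pr a := by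
  induction n with
  | zero => simp
  | succ n ih => rw [pow_succ, pr_mul, ih, succ_nsmul]

/-- The element `(x, n)` of `L` (for `n = 0 ⇒ 0 ≤ x`). [cite: MochizukiFrdI2008, Def. 1.1(i) p.19] -/
def lel (x : ℝ) (n : ℕ) (h : n = 0 → 0 ≤ x) : L := Multiplicative.ofAdd ⟨(x, n), h⟩

/-- The underlying pair of `lel x n h`. [cite: MochizukiFrdI2008, Def. 1.1(i) p.19] -/
@[simp] theorem pr_lel (x : ℝ) (n : ℕ) (h : n = 0 → 0 ≤ x) : pr (lel x n h) = (x, n) := rfl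

/-- In `L`, `a + b = 0` forces `a = 0` (no units but `0`). [cite: MochizukiFrdI2008, §0 p.11] -/
theorem lexCone_eq_zero_of_add_eq_zero (a b : lexCone) (hab : a + b = 0) : a = 0 := by
  have h : (a : ℝ × ℕ) + (b : ℝ × ℕ) = 0 := by
    have := congrArg (fun p : lexCone => (p : ℝ × ℕ)) hab
    simpa using this
  have h2 : (a : ℝ × ℕ).2 + (b : ℝ × ℕ).2 = 0 := by simpa using congrArg Prod.snd h
  have h1 : (a : ℝ × ℕ).1 + (b : ℝ × ℕ).1 = 0 := by simpa using congrArg Prod.fst h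
  obtain ⟨ha2, hb2⟩ := Nat.add_eq_zero_iff.mp h2
  have ha1 : 0 ≤ (a : ℝ × ℕ).1 := a.2 ha2
  have hb1 : 0 ≤ (b : ℝ × ℕ).1 := b.2 hb2
  exact Subtype.ext (Prod.ext (by simp; linarith) (by simpa using ha2))

/-- `L` is sharp. [cite: MochizukiFrdI2008, §0 p.11] -/
theorem isSharp_L : IsSharp L := by
  refine ⟨fun a ha => ?_⟩
  obtain ⟨u, rfl⟩ := ha
  have h : Multiplicative.toAdd (u : L) + Multiplicative.toAdd ((u⁻¹ : Lˣ) : L) = 0 := by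
    rw [← toAdd_mul, Units.mul_inv, toAdd_one]
  exact Multiplicative.toAdd.injective (lexCone_eq_zero_of_add_eq_zero _ _ h)

/-- **`L` is a divisorial monoid** (integral, saturated, of characteristic type, sharp — Def. 1.1
(i)): saturation holds because `n·a = c + n·b` in `L` forces `b ≤ a` coordinatewise-lexicographically.
[cite: MochizukiFrdI2008, Def. 1.1(i) p.19] -/
theorem isDivisorial_L : IsDivisorial L := by
  refine isDivisorial_multiplicative_of lexCone_eq_zero_of_add_eq_zero ?_
  intro a b c n hn h
  have h' : n • (a : ℝ × ℕ) = (c : ℝ × ℕ) + n • (b : ℝ × ℕ) := by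
    have := congrArg (fun p : lexCone => (p : ℝ × ℕ)) h
    simpa using this
  have h2 : n * (a : ℝ × ℕ).2 = (c : ℝ × ℕ).2 + n * (b : ℝ × ℕ).2 := by
    simpa using congrArg Prod.snd h'
  have h1 : (n : ℝ) * (a : ℝ × ℕ).1 = (c : ℝ × ℕ).1 + (n : ℝ) * (b : ℝ × ℕ).1 := by
    simpa [nsmul_eq_mul] using congrArg Prod.fst h'
  have hba2 : (b : ℝ × ℕ).2 ≤ (a : ℝ × ℕ).2 := by
    by_contra hlt
    have : n * (a : ℝ × ℕ).2 < n * (b : ℝ × ℕ).2 := Nat.mul_lt_mul_of_pos_left (lt_of_not_ge hlt) hn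
    omega
  have hd : (a : ℝ × ℕ).2 - (b : ℝ × ℕ).2 = 0 → 0 ≤ (a : ℝ × ℕ).1 - (b : ℝ × ℕ).1 := by
    intro h0
    have he : (a : ℝ × ℕ).2 = (b : ℝ × ℕ).2 := by omega
    have hc2 : (c : ℝ × ℕ).2 = 0 := by
      rw [he] at h2
      omega
    have hc1 : 0 ≤ (c : ℝ × ℕ).1 := c.2 hc2
    have hn' : (0 : ℝ) < n := by exact_mod_cast hn
    nlinarith
  refine ⟨⟨((a : ℝ × ℕ).1 - (b : ℝ × ℕ).1, (a : ℝ × ℕ).2 - (b : ℝ × ℕ).2), hd⟩, ?_⟩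
  apply Subtype.ext
  refine Prod.ext ?_ ?_
  · simp
  · simp; omega

/-! ### Powers of two and the scaling maps -/

/-- `2^i ∈ ℝ_{≥0}` for `i ∈ ℤ`. [cite: MochizukiFrdI2008, Def. 1.1(ii) p.19] -/
def tw (i : ℤ) : ℝ≥0 := (2 : ℝ≥0) ^ i

/-- `2^i · 2^j = 2^(i+j)`. [cite: MochizukiFrdI2008, Def. 1.1(ii) p.19] -/
theorem tw_mul (i j : ℤ) : tw i * tw j = tw (i + j) := (zpow_add₀ two_ne_zero i j).symm

/-- `2^0 = 1`. [cite: MochizukiFrdI2008, Def. 1.1(ii) p.19] -/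
@[simp] theorem tw_zero : tw 0 = 1 := zpow_zero _

/-- `2^i ≠ 0`. [cite: MochizukiFrdI2008, Def. 1.1(ii) p.19] -/
theorem tw_ne_zero (i : ℤ) : tw i ≠ 0 := zpow_ne_zero i two_ne_zero

/-- `2^i ≤ 1` for `i ≤ 0`. [cite: MochizukiFrdI2008, Def. 1.1(ii) p.19] -/
theorem tw_le_one {i : ℤ} (hi : i ≤ 0) : tw i ≤ 1 := zpow_le_one_of_nonpos₀ one_le_two hi

/-- `2^i` as a real number. [cite: MochizukiFrdI2008, Def. 1.1(ii) p.19] -/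
theorem coe_tw (i : ℤ) : ((tw i : ℝ≥0) : ℝ) = (2 : ℝ) ^ i := NNReal.coe_zpow 2 i

/-- `2^i ≠ 0` as a real number. [cite: MochizukiFrdI2008, Def. 1.1(ii) p.19] -/
theorem coe_tw_ne_zero (i : ℤ) : ((tw i : ℝ≥0) : ℝ) ≠ 0 := by
  rw [coe_tw]; exact zpow_ne_zero i two_ne_zero

/-- Scaling `x ↦ t·x` of `ℝ_{≥0}` (written multiplicatively). [cite: MochizukiFrdI2008, Def. 1.1(ii) p.19] -/
def nnScale (t : ℝ≥0) : Multiplicative ℝ≥0 →* Multiplicative ℝ≥0 :=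
  AddMonoidHom.toMultiplicative (AddMonoidHom.mulLeft t)

/-- `nnScale t` in additive coordinates. [cite: MochizukiFrdI2008, Def. 1.1(ii) p.19] -/
@[simp] theorem toAdd_nnScale (t : ℝ≥0) (x : Multiplicative ℝ≥0) :
    Multiplicative.toAdd (nnScale t x) = t * Multiplicative.toAdd x := rfl

/-- `nnScale t (ofAdd x) = ofAdd (t·x)`. [cite: MochizukiFrdI2008, Def. 1.1(ii) p.19] -/
@[simp] theorem nnScale_ofAdd (t x : ℝ≥0) :
    nnScale t (Multiplicative.ofAdd x) = Multiplicative.ofAdd (t * x) := rfl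

/-- `nnScale 1` is the identity. [cite: MochizukiFrdI2008, Def. 1.1(ii) p.19] -/
@[simp] theorem nnScale_one_apply (x : Multiplicative ℝ≥0) : nnScale 1 x = x :=
  Multiplicative.toAdd.injective (by simp)

/-- Composition of scalings. [cite: MochizukiFrdI2008, Def. 1.1(ii) p.19] -/
theorem nnScale_nnScale (s t : ℝ≥0) (x : Multiplicative ℝ≥0) :
    nnScale s (nnScale t x) = nnScale (s * t) x :=
  Multiplicative.toAdd.injective (by simp [mul_assoc])

/-- `nnScale t` is injective for `t ≠ 0`. [cite: MochizukiFrdI2008, Def. 1.1(ii) p.19] -/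
theorem nnScale_injective {t : ℝ≥0} (ht : t ≠ 0) : Function.Injective (nnScale t) := by
  intro x y h
  have h' : t * Multiplicative.toAdd x = t * Multiplicative.toAdd y := by
    rw [← toAdd_nnScale, ← toAdd_nnScale, h]
  exact Multiplicative.toAdd.injective (mul_left_cancel₀ ht h')

/-- `nnScale (2^i)` is bijective (inverse `nnScale (2^(-i))`). [cite: MochizukiFrdI2008, Def. 1.1(ii) p.19] -/
theorem nnScale_tw_bijective (i : ℤ) : Function.Bijective (nnScale (tw i)) := by
  refine ⟨nnScale_injective (tw_ne_zero i), fun y => ⟨nnScale (tw (-i)) y, ?_⟩⟩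
  rw [nnScale_nnScale, tw_mul, add_neg_cancel, tw_zero]
  exact Multiplicative.toAdd.injective (by simp)

/-- Scaling `(x, n) ↦ (t·x, n)` of the lexicographic cone. [cite: MochizukiFrdI2008, Def. 1.1(ii) p.19] -/
def lexScaleAdd (t : ℝ≥0) : lexCone →+ lexCone where
  toFun p := ⟨((t : ℝ) * (p : ℝ × ℕ).1, (p : ℝ × ℕ).2), fun h0 => mul_nonneg t.2 (p.2 h0)⟩
  map_zero' := Subtype.ext (Prod.ext (by simp) (by simp))
  map_add' p q := Subtype.ext (Prod.ext (by simp [mul_add]) (by simp))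

/-- Scaling `(x, n) ↦ (t·x, n)` of `L` (written multiplicatively). [cite: MochizukiFrdI2008, Def. 1.1(ii) p.19] -/
def lexScale (t : ℝ≥0) : L →* L := AddMonoidHom.toMultiplicative (lexScaleAdd t)

/-- `lexScale t` on underlying pairs. [cite: MochizukiFrdI2008, Def. 1.1(ii) p.19] -/
@[simp] theorem pr_lexScale (t : ℝ≥0) (a : L) : pr (lexScale t a) = ((t : ℝ) * (pr a).1, (pr a).2) := rfl

/-- The embedding `x ↦ (t·x, 0)` of `ℝ_{≥0}` into the lexicographic cone. [cite: MochizukiFrdI2008, Def. 1.1(ii) p.19] -/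
def lexEmbAdd (t : ℝ≥0) : ℝ≥0 →+ lexCone where
  toFun x := ⟨((t : ℝ) * x, 0), fun _ => mul_nonneg t.2 x.2⟩
  map_zero' := Subtype.ext (Prod.ext (by simp) rfl)
  map_add' x y := Subtype.ext (Prod.ext (by simp [mul_add]) rfl)

/-- The embedding `x ↦ (t·x, 0)` of `ℝ_{≥0}` into `L` (written multiplicatively).
[cite: MochizukiFrdI2008, Def. 1.1(ii) p.19] -/
def lexEmb (t : ℝ≥0) : Multiplicative ℝ≥0 →* L := AddMonoidHom.toMultiplicative (lexEmbAdd t)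

/-- `lexEmb t` on underlying pairs. [cite: MochizukiFrdI2008, Def. 1.1(ii) p.19] -/
@[simp] theorem pr_lexEmb (t : ℝ≥0) (x : Multiplicative ℝ≥0) :
    pr (lexEmb t x) = ((t : ℝ) * (Multiplicative.toAdd x : ℝ≥0), 0) := rfl

/-- `lexScale 1` is the identity. [cite: MochizukiFrdI2008, Def. 1.1(ii) p.19] -/
@[simp] theorem lexScale_one_apply (a : L) : lexScale 1 a = a := L_ext (by simp)

/-- Composition of scalings of `L`. [cite: MochizukiFrdI2008, Def. 1.1(ii) p.19] -/
theorem lexScale_lexScale (s t : ℝ≥0) (a : L) : lexScale s (lexScale t a) = lexScale (s * t) a :=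
  L_ext (by simp [mul_assoc])

/-- A scaling after an embedding is an embedding. [cite: MochizukiFrdI2008, Def. 1.1(ii) p.19] -/
theorem lexScale_lexEmb (s t : ℝ≥0) (x : Multiplicative ℝ≥0) : lexScale s (lexEmb t x) = lexEmb (s * t) x :=
  L_ext (by simp [mul_assoc])

/-- An embedding after a scaling is an embedding. [cite: MochizukiFrdI2008, Def. 1.1(ii) p.19] -/
theorem lexEmb_nnScale (s t : ℝ≥0) (x : Multiplicative ℝ≥0) : lexEmb s (nnScale t x) = lexEmb (s * t) x :=
  L_ext (by simp [mul_assoc])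

/-- `lexScale t` is injective for `t ≠ 0`. [cite: MochizukiFrdI2008, Def. 1.1(ii) p.19] -/
theorem lexScale_injective {t : ℝ≥0} (ht : t ≠ 0) : Function.Injective (lexScale t) := by
  intro a b h
  have h' := congrArg pr h
  simp only [pr_lexScale, Prod.mk.injEq] at h'
  have ht' : (t : ℝ) ≠ 0 := by exact_mod_cast ht
  exact L_ext (Prod.ext (mul_left_cancel₀ ht' h'.1) h'.2)

/-- `lexScale (2^i)` is bijective (inverse `lexScale (2^(-i))`). [cite: MochizukiFrdI2008, Def. 1.1(ii) p.19] -/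
theorem lexScale_tw_bijective (i : ℤ) : Function.Bijective (lexScale (tw i)) := by
  refine ⟨lexScale_injective (tw_ne_zero i), fun y => ⟨lexScale (tw (-i)) y, L_ext ?_⟩⟩
  rw [lexScale_lexScale, tw_mul, add_neg_cancel, tw_zero]
  simp

/-- `lexEmb t` is injective for `t ≠ 0`. [cite: MochizukiFrdI2008, Def. 1.1(ii) p.19] -/
theorem lexEmb_injective {t : ℝ≥0} (ht : t ≠ 0) : Function.Injective (lexEmb t) := by
  intro x y h
  have h' := congrArg (fun a => (pr a).1) h
  simp only [pr_lexEmb] at h'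
  have ht' : (t : ℝ) ≠ 0 := by exact_mod_cast ht
  exact Multiplicative.toAdd.injective (NNReal.coe_injective (mul_left_cancel₀ ht' h'))

/-! ### The divisor monoid `Φt` on `D` -/

/-- `Φt` on objects: `Φt(P) = Φt(Q) = ℝ_{≥0}`, `Φt(E) = L`. [cite: MochizukiFrdI2008, Def. 1.1(ii) p.19] -/
abbrev Φobj : Dob → CommMonCat.{0}
  | .P => CommMonCat.of (Multiplicative ℝ≥0)
  | .Q => CommMonCat.of (Multiplicative ℝ≥0)
  | .E => CommMonCat.of L

/-- `Φt` on arrows (the pull-back maps): `(b k)^* = ×4^k`, `(f j)^* = ×4^{-j}`, `(c k)^* = ×4^k` on the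
real coordinate, `(φ i)^* = ×2^i`, `(h i)^* = x ↦ (2^i x, 0)`. [cite: MochizukiFrdI2008, Def. 1.1(ii) p.19] -/
def Φmap : ∀ {X Y : Dob}, (X ⟶ Y) → (Φobj Y ⟶ Φobj X)
  | _, _, Dhom.b k => CommMonCat.ofHom (nnScale (tw (2 * k)))
  | _, _, Dhom.f j => CommMonCat.ofHom (nnScale (tw (-(2 * (j : ℤ)))))
  | _, _, Dhom.c k => CommMonCat.ofHom (lexScale (tw (2 * k)))
  | _, _, Dhom.φ i => CommMonCat.ofHom (nnScale (tw i))
  | _, _, Dhom.h i => CommMonCat.ofHom (lexEmb (tw i))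

/-- `Φt` respects identities. [cite: MochizukiFrdI2008, Def. 1.1(ii) p.19] -/
theorem Φmap_id (X : Dob) : Φmap (𝟙 X) = 𝟙 (Φobj X) := by
  cases X <;> apply CommMonCat.hom_ext <;> refine MonoidHom.ext fun x => ?_
  · simp [Φmap]
  · simp [Φmap]
  · simp [Φmap]

/-- `Φt` is contravariantly functorial: `(v ≫ u)^* = v^* ∘ u^*`. [cite: MochizukiFrdI2008, Def. 1.1(ii) p.19] -/
theorem Φmap_comp {X Y Z : Dob} (v : X ⟶ Y) (u : Y ⟶ Z) : Φmap (v ≫ u) = Φmap u ≫ Φmap v := by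
  cases v <;> cases u <;> apply CommMonCat.hom_ext <;> refine MonoidHom.ext fun x => ?_
  · -- b, b
    simp only [b_comp_b, Φmap, CommMonCat.hom_ofHom, CommMonCat.hom_comp, MonoidHom.coe_comp,
      Function.comp_apply, nnScale_nnScale, tw_mul]
    exact congrArg (fun e => nnScale (tw e) x) (by ring)
  · -- b, φ
    simp only [b_comp_φ, Φmap, CommMonCat.hom_ofHom, CommMonCat.hom_comp, MonoidHom.coe_comp,
      Function.comp_apply, nnScale_nnScale, tw_mul]
    exact congrArg (fun e => nnScale (tw e) x) (by ring)
  · -- f, f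
    simp only [f_comp_f, Φmap, CommMonCat.hom_ofHom, CommMonCat.hom_comp, MonoidHom.coe_comp,
      Function.comp_apply, nnScale_nnScale, tw_mul]
    exact congrArg (fun e => nnScale (tw e) x) (by push_cast; ring)
  · -- c, c
    simp only [c_comp_c, Φmap, CommMonCat.hom_ofHom, CommMonCat.hom_comp, MonoidHom.coe_comp,
      Function.comp_apply, lexScale_lexScale, tw_mul]
    exact congrArg (fun e => lexScale (tw e) x) (by ring)
  · -- c, h
    simp only [c_comp_h, Φmap, CommMonCat.hom_ofHom, CommMonCat.hom_comp, MonoidHom.coe_comp,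
      Function.comp_apply, lexScale_lexEmb, tw_mul]
    exact congrArg (fun e => lexEmb (tw e) x) (by ring)
  · -- φ, f
    simp only [φ_comp_f, Φmap, CommMonCat.hom_ofHom, CommMonCat.hom_comp, MonoidHom.coe_comp,
      Function.comp_apply, nnScale_nnScale, tw_mul]
    exact congrArg (fun e => nnScale (tw e) x) (by ring)
  · -- h, f
    simp only [h_comp_f, Φmap, CommMonCat.hom_ofHom, CommMonCat.hom_comp, MonoidHom.coe_comp,
      Function.comp_apply, lexEmb_nnScale, tw_mul]
    exact congrArg (fun e => lexEmb (tw e) x) (by ring)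

/-- **The divisor monoid `Φt : Dᵒᵖ → Mon`** of the witness (reducible, so that `Φt(P)`, `Φt(Q)`, `Φt(E)`
unfold to `ℝ_{≥0}`, `ℝ_{≥0}`, `L` during elaboration). [cite: MochizukiFrdI2008, Def. 1.1(ii) p.19] -/
abbrev Φt : Dobᵒᵖ ⥤ CommMonCat.{0} where
  obj A := Φobj A.unop
  map u := Φmap u.unop
  map_id A := Φmap_id A.unop
  map_comp u v := Φmap_comp v.unop u.unop

/-- The pull-back along `b k` is `×4^k`. [cite: MochizukiFrdI2008, Def. 1.1(ii) p.19] -/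
@[simp] theorem pull_b (k : ℤ) (x : Multiplicative ℝ≥0) :
    pull Φt (Dhom.b k : Dob.P ⟶ Dob.P) x = nnScale (tw (2 * k)) x := rfl
/-- The pull-back along `f j` is `×4^{-j}`. [cite: MochizukiFrdI2008, Def. 1.1(ii) p.19] -/
@[simp] theorem pull_f (j : ℕ) (x : Multiplicative ℝ≥0) :
    pull Φt (Dhom.f j : Dob.Q ⟶ Dob.Q) x = nnScale (tw (-(2 * (j : ℤ)))) x := rfl
/-- The pull-back along `c k` is `(x, n) ↦ (4^k x, n)`. [cite: MochizukiFrdI2008, Def. 1.1(ii) p.19] -/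
@[simp] theorem pull_c (k : ℤ) (a : L) :
    pull Φt (Dhom.c k : Dob.E ⟶ Dob.E) a = lexScale (tw (2 * k)) a := rfl
/-- The pull-back along `φ i` is `×2^i`. [cite: MochizukiFrdI2008, Def. 1.1(ii) p.19] -/
@[simp] theorem pull_φ (i : ℤ) (x : Multiplicative ℝ≥0) :
    pull Φt (Dhom.φ i : Dob.P ⟶ Dob.Q) x = nnScale (tw i) x := rfl
/-- The pull-back along `h i` is `x ↦ (2^i x, 0)`. [cite: MochizukiFrdI2008, Def. 1.1(ii) p.19] -/
@[simp] theorem pull_h (i : ℤ) (x : Multiplicative ℝ≥0) :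
    pull Φt (Dhom.h i : Dob.E ⟶ Dob.Q) x = lexEmb (tw i) x := rfl

/-- The pull-back along `b k`, as a homomorphism. [cite: MochizukiFrdI2008, Def. 1.1(ii) p.19] -/
theorem pullHom_b (k : ℤ) : pull Φt (Dhom.b k : Dob.P ⟶ Dob.P) = nnScale (tw (2 * k)) := rfl
/-- The pull-back along `f j`, as a homomorphism. [cite: MochizukiFrdI2008, Def. 1.1(ii) p.19] -/
theorem pullHom_f (j : ℕ) : pull Φt (Dhom.f j : Dob.Q ⟶ Dob.Q) = nnScale (tw (-(2 * (j : ℤ)))) := rfl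
/-- The pull-back along `c k`, as a homomorphism. [cite: MochizukiFrdI2008, Def. 1.1(ii) p.19] -/
theorem pullHom_c (k : ℤ) : pull Φt (Dhom.c k : Dob.E ⟶ Dob.E) = lexScale (tw (2 * k)) := rfl
/-- The pull-back along `φ i`, as a homomorphism. [cite: MochizukiFrdI2008, Def. 1.1(ii) p.19] -/
theorem pullHom_φ (i : ℤ) : pull Φt (Dhom.φ i : Dob.P ⟶ Dob.Q) = nnScale (tw i) := rfl
/-- The pull-back along `h i`, as a homomorphism. [cite: MochizukiFrdI2008, Def. 1.1(ii) p.19] -/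
theorem pullHom_h (i : ℤ) : pull Φt (Dhom.h i : Dob.E ⟶ Dob.Q) = lexEmb (tw i) := rfl

/-- An injective homomorphism into a sharp monoid is characteristically injective (as in
`PadicFrobenioidZeroMonoid.lean`). [cite: MochizukiFrdI2008, §0 p.11] -/
private theorem isCharInjective_of_injective_of_isSharp' {M N : Type} [CommMonoid M] [CommMonoid N]
    (g : M →* N) (hg : Function.Injective g) (hN : IsSharp N) : IsCharInjective g := by
  refine ⟨hg, fun x y hxy => ?_⟩
  obtain ⟨a, rfl⟩ := Associates.mk_surjective x
  obtain ⟨b, rfl⟩ := Associates.mk_surjective y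
  rw [associatesMap_mk, associatesMap_mk, Associates.mk_eq_mk_iff_associated] at hxy
  obtain ⟨u, hu⟩ := hxy
  have hu1 : (u : N) = 1 := hN.1 _ u.isUnit
  rw [hu1, mul_one] at hu
  rw [hg hu]

/-- **`Φt` is a monoid on `D`** (Def. 1.1 (ii)): every pull-back is (characteristically) injective, and
the pull-backs along FSM-morphisms — the isomorphisms and the `f j` — are bijective (`h i` is not an
FSM-morphism). [cite: MochizukiFrdI2008, Def. 1.1(ii) p.19] -/
theorem isMonoidOn_Φt : IsMonoidOn Φt := by
  refine ⟨fun u => ?_, fun u hu => ?_⟩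
  · cases u with
    | b k =>
      rw [pullHom_b]
      exact isCharInjective_of_injective_of_isSharp' _ (nnScale_injective (tw_ne_zero _))
        ArchFrd.isSharp_nnreal
    | f j =>
      rw [pullHom_f]
      exact isCharInjective_of_injective_of_isSharp' _ (nnScale_injective (tw_ne_zero _))
        ArchFrd.isSharp_nnreal
    | c k =>
      rw [pullHom_c]
      exact isCharInjective_of_injective_of_isSharp' _ (lexScale_injective (tw_ne_zero _)) isSharp_L
    | φ i =>
      rw [pullHom_φ]
      exact isCharInjective_of_injective_of_isSharp' _ (nnScale_injective (tw_ne_zero _))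
        ArchFrd.isSharp_nnreal
    | h i =>
      rw [pullHom_h]
      exact isCharInjective_of_injective_of_isSharp' _ (lexEmb_injective (tw_ne_zero _)) isSharp_L
  · cases u with
    | b k => rw [pullHom_b]; exact nnScale_tw_bijective _
    | f j => rw [pullHom_f]; exact nnScale_tw_bijective _
    | c k => rw [pullHom_c]; exact lexScale_tw_bijective _
    | φ i => rw [pullHom_φ]; exact nnScale_tw_bijective _
    | h i => exact absurd hu (not_isFSM_h i)

/-- `Φt` is (objectwise) divisorial: `ℝ_{≥0}` (`ArchFrd.isDivisorial_nnreal`) and `L` (`isDivisorial_L`).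
[cite: MochizukiFrdI2008, Def. 1.1(i) p.19] -/
theorem isDivisorial_Φt : Objectwise (fun M _ => IsDivisorial M) Φt := by
  rintro ⟨⟩
  · exact ArchFrd.isDivisorial_nnreal
  · exact ArchFrd.isDivisorial_nnreal
  · exact isDivisorial_L

/-! ### The data `(Φt, 0_D, 0)` and its model Frobenioid -/

/-- `Div_B = 0 : 0_D → Φt^gp` (the rational-function monoid of the witness is trivial).
[cite: MochizukiFrdI2008, Thm. 5.2 p.100] -/
def divZero : zeroMonoid.{0} Dob ⟶ monoidGp Φt where
  app A := CommMonCat.ofHom 1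
  naturality A B u := by
    apply CommMonCat.hom_ext
    ext x
    rw [Subsingleton.elim x 1, map_one, map_one]

/-- `Div_B` of the witness is identically `0`. [cite: MochizukiFrdI2008, Thm. 5.2 p.100] -/
@[simp] theorem divB_divZero (X : Dobᵒᵖ) (u : (zeroMonoid.{0} Dob).obj X) :
    divB Φt (zeroMonoid.{0} Dob) divZero X u = 1 := rfl

/-- A one-element commutative monoid is group-like (as `isGroupLike_of_forall_isUnit` of
`PadicFrobenioidIsFrobenioid.lean`). [cite: MochizukiFrdI2008, Def. 1.1(i) p.19] -/
private theorem isGroupLike_of_subsingleton {M : Type} [CommMonoid M] [Subsingleton M] : IsGroupLike M := by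
  refine ⟨⟨⟨fun a b _ => Subsingleton.elim a b⟩, ⟨fun x _ _ _ => ⟨1, ?_⟩⟩,
    ⟨fun u _ _ => Units.ext (Subsingleton.elim _ _)⟩⟩, ⟨fun x y => ?_⟩⟩
  · obtain ⟨a, b, hab⟩ := gp_exists_mul_of_eq_of x
    rw [Subsingleton.elim a 1, Subsingleton.elim b 1, map_one, mul_one] at hab
    rw [map_one, hab]
  · obtain ⟨a, rfl⟩ := Associates.mk_surjective x
    obtain ⟨b, rfl⟩ := Associates.mk_surjective y
    rw [Subsingleton.elim a b]

/-- `0_D` is (objectwise) group-like. [cite: MochizukiFrdI2008, Def. 1.1(i) p.19] -/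
theorem isGroupLike_zeroMonoid : Objectwise (fun M _ => IsGroupLike M) (zeroMonoid.{0} Dob) :=
  fun _ => isGroupLike_of_subsingleton

/-- **The Frobenioid of the witness**: the model Frobenioid ([FrdI] Thm. 5.2 (i)) of the data
`(Φt, 0_D, 0)` over `D`. [cite: MochizukiFrdI2008, Thm. 5.2(i) p.100] -/
abbrev C : Type := ModelFrobenioid Φt (zeroMonoid.{0} Dob) divZero

/-- Its pre-Frobenioid structure `C → F_Φ` (Thm. 5.2 (i)). [cite: MochizukiFrdI2008, Thm. 5.2(i) p.100] -/
abbrev F : C ⥤ ElemFrobenioid Φt := ModelFrobenioid.toElem Φt (zeroMonoid.{0} Dob) divZero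

/-- **`C → F_Φ` is a Frobenioid** — an instance of the cell's kernel theorem for [FrdI] Thm. 5.2 (ii)
(`ModelFrobenioid.isFrobenioid`: `Φt` a divisorial monoid on `D`, `0_D` group-like, `D` connected and
totally epimorphic). [cite: MochizukiFrdI2008, Thm. 5.2(ii) p.101] -/
theorem isFrobenioid : PreFrobenioid.IsFrobenioid F :=
  ModelFrobenioid.isFrobenioid isMonoidOn_Φt isDivisorial_Φt isMonoidOn_zeroMonoid isGroupLike_zeroMonoid
    isGraphConnected isTotallyEpimorphic

/-! ### The distinguished objects -/

/-- An element `x ∈ ℝ_{≥0} = Φt(Q)`. [cite: MochizukiFrdI2008, Thm. 5.2(i) p.100] -/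
abbrev qel (x : ℝ≥0) : Φt.obj (op Dob.Q) := (Multiplicative.ofAdd x : Multiplicative ℝ≥0)

/-- An element `x ∈ ℝ_{≥0} = Φt(P)`. [cite: MochizukiFrdI2008, Thm. 5.2(i) p.100] -/
abbrev pel (x : ℝ≥0) : Φt.obj (op Dob.P) := (Multiplicative.ofAdd x : Multiplicative ℝ≥0)

/-- An element `(x, n) ∈ L = Φt(E)`. [cite: MochizukiFrdI2008, Thm. 5.2(i) p.100] -/
abbrev eel (x : ℝ) (n : ℕ) (h : n = 0 → 0 ≤ x) : Φt.obj (op Dob.E) := lel x n h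

/-- The class `α₀ = −1 ∈ ℝ = Φt(Q)^gp` (NOT effective). [cite: MochizukiFrdI2008, Thm. 5.2(i) p.100] -/
abbrev α₀ : Algebra.GrothendieckGroup (Φt.obj (op Dob.Q)) := (Algebra.GrothendieckGroup.of (qel 1))⁻¹

/-- **The object `A = (Q, −1)` of `C`** (it will be `Aut^sub`-ample). [cite: MochizukiFrdI2008, Prop. 1.6(vi) p.28] -/
abbrev A : C := ⟨Dob.Q, α₀⟩

/-- `(0, 1) ∈ L`. [cite: MochizukiFrdI2008, Thm. 5.2(i) p.100] -/
abbrev e01 : Φt.obj (op Dob.E) := eel 0 1 (fun h => absurd h one_ne_zero)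

/-- The class `δ = −(0, 1) ∈ L^gp = Φt(E)^gp` (fixed by every `(c k)^*`). [cite: MochizukiFrdI2008, Thm. 5.2(i) p.100] -/
abbrev δ : Algebra.GrothendieckGroup (Φt.obj (op Dob.E)) := (Algebra.GrothendieckGroup.of e01)⁻¹

/-- **The witness object `Y = (E, −(0,1))` of `C`** (domain of the sub-automorphism witnesses of `A`).
[cite: MochizukiFrdI2008, Prop. 1.6(vi) p.28] -/
abbrev Y : C := ⟨Dob.E, δ⟩

/-- **The object `X = (A, Q, id)` of `C′ = C ×_D D`** (fiber product along `κ`; it projects to `A` but will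
NOT be `Aut^sub`-ample). [cite: MochizukiFrdI2008, Prop. 1.6(vi) p.28] -/
abbrev X : PreFrobenioid.FiberProduct F κ := ⟨A, Dob.Q, Iso.refl Dob.Q⟩

/-- `pr (0,1) = (0,1)`. [cite: MochizukiFrdI2008, Thm. 5.2(i) p.100] -/
@[simp] theorem pr_e01 : pr e01 = (0, 1) := rfl

end SubAmpleTest

end Literature.AlgebraicGeometry.Frobenioids

end
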